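import Summits.AtomisticToContinuum.Crystallization.Theorems.ChartedZeroExcessLayeredLatticeLiouvilleZZZXA

/-!
# ChartedZeroExcess · LayeredLatticeLiouville ZZZXB (lens-2 g89 NODE 89 part 3c «LightTree», ADDENDUM to tree ZZZXA) — LEAVES CARRY NO TRIPOD.
# Tree ZZZXA's leaf of record (RG-lab) `CoreLabelTreeP` asks a fat label tripod at EVERY non-root core atom; at the BOUNDARY atoms of the `ρ`-core (only
# `4–6` of their twelve neighbours inside the core) that is a finite first-shell case analysis (which in-core label triples are non-coplanar).  It is
# unnecessary: a LEAF of the frame tree is tied to the root frame through ITS PARENT'S ROW of the deficit (`‖xf i − A_{par i}(y i)‖ ≤ √D`) and the parent's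
# chain; only INTERNAL nodes (parents) must hand their frame on, and those can be chosen `≥ 3` bond-hops inside the core (parent = up to three hops inward,
# label range `3·28/25 + 28/25 ≤ 121/25`), where all twelve neighbours are core atoms and the tripod is the preimage of a canonical fat crystal triple.
#   (RG-lab″) `CoreLightLabelTreeP … Rd N₀ H₀ μC ΔC …` := (RG-lab) with `IsLabelTree` ↦ `IsLightLabelTree` (tripod clauses only at `par i` whenever `dep (par i)
#   ≠ 0`); (RG-fin″) `rigidMisfit_root_le_of_lightLabelTree` — the conclusion of (RG-fin′) VERBATIM from the light tree (PROVED; the site bound `H·c·√D` is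
#   unchanged because `c ≥ 1`); GLUE `deficitRigidityP_of_coreLightLabelTree` (same explicit `cR`, PROVED); DOORS `mildCoherentMoatCorePG_W2c_of_lightLabelTree`
#   and ★ `mildCoherentMoatCorePG_W2c_exactWell_light` = tree ZZZXA's exact-well door of record with `hLT : CoreLabelTreeP` ↦ `hLT : CoreLightLabelTreeP`, every
#   other binder byte-identical (PROVED); and `coreLightLabelTreeP_of_coreLabelTreeP` : (RG-lab) ⟹ (RG-lab″) (PROVED) — the hypothesis only WEAKENS.
# 0 sorry · import = tree ZZZXA only · 3 Prop-defs (`TripodAt`, `IsLightLabelTree`, `CoreLightLabelTreeP`) · no instances/notation · axioms standard.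
WHAT REMAINS S-SIDE, (RG-lab″) [KINEMATIC · LJ-free · y-free · V-free · deficit-free · S-SIDE COMBINATORIAL GEOMETRY · NEW · UNDECIDED · TRUE-type at `Rd = 121/25`
· ATTACKABLE-S · size S–M] (memo PLAN-g90-RGlab): root `k₀ ∈ K`; potential `Φ = dist(·, K)` (then `dist(·, k₀)` inside `B̄(k₀, 9)`); descent hops exist in
`S` itself by `IsCleanP` (isometric first shell, `exists_unit_inner_ge_of_pattern`, tree ZZZVA `descent_gain`: `D′² ≤ D² − 1/100`, and `≥ 0.45` per hop
while `D ≥ 3`); PARENT = one hop when `Φ ≤ 13`, THREE hops when `Φ > 13` (so every internal node has `Φ ≤ 14.8`, all twelve neighbours in the core);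
TRIPOD at an internal node = label-preimages of a canonical fat triple of the crystal star (two disjoint ones exist: fcc `{(1,1,0),(1,0,1),(0,1,1)}`-type and
its negative, hcp the upper and the lower triangle), fatness of the placed (near-isometric) triple by the injectivity bootstrap `‖Bα‖ ≥ (μ₀ − 3τ)‖α‖₁`;
`N₀` by packing, `ΔC` by label chains.  No graph-automorphism rigidity, no boundary case table. -/

noncomputable section
open scoped BigOperators Classical InnerProductSpace RealInnerProductSpace
open MeasureTheory Set Metric Filter Topology
open Literature.Geometry.DiscreteGeometry (IsTwoShellGoodSet)
open Literature.MathematicalPhysics.StatisticalMechanics (lennardJones card_le_of_separated_of_dist_le)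

namespace Summit.AtomisticToContinuum.Crystallization.Theorems.ChartedZeroExcessLayeredLatticeLiouville

open Summit.AtomisticToContinuum.Crystallization.Theorems.ChartedPlanarOrderRigidityDoor (E3 IsClean atomsIn)
open Summit.AtomisticToContinuum.Crystallization.Theorems.ChartedPlanarOrderDensityDichotomy (μS IsSep)
open Summit.AtomisticToContinuum.Crystallization.Theorems.ChartedPlanarOrderCleanScaleP (IsCleanP IsDoorSetP)
open Summit.AtomisticToContinuum.Crystallization.Theorems.ChartedPlanarOrderMesoCut (LayeredHom EnvClose)
open Summit.AtomisticToContinuum.Crystallization.Theorems.ChartedPlanarOrderDoorLayeredOsc (IsTwoShellAffineGood)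

/-! ### ZZZXB-1  (RG-fin″) the leaf-light frame tree (finite-dimensional, PROVED) -/

section LightTree

variable {n : ℕ} {Rd μ sv dB ΔC : ℝ} {H : ℕ} {y₀ y xf : Fin n → E3} {V : Fin n → (E3 ≃ₗᵢ[ℝ] E3)}

/-- ★ **ONE EDGE, PER-NODE FORM (PROVED)** — the operator-norm bootstrap of tree ZZZXA `labelTree_parent_sub_le` with the tree unbundled: a node `j`
with a designated `p` in label range `Rd`, a label tripod `tr` in range of both with `ℓ¹`-fatness `μ`, filling tripod vectors within `sv < μ` of the label
ones, sites within `dB` of the labels, label diameter `ΔC`: the frames of `p` and `j` differ everywhere by `≤ (1 + 3(ΔC + 2dB)/(μ − sv))·√D`. [this file, g89] -/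
theorem frameEdge_sub_le {p j : Fin n} {tr : Fin 3 → Fin n} (hs : 0 ≤ sv) (hsμ : sv < μ) (hpar : dist (y₀ p) (y₀ j) ≤ Rd)
    (htri : ∀ m, dist (y₀ p) (y₀ (tr m)) ≤ Rd ∧ dist (y₀ j) (y₀ (tr m)) ≤ Rd)
    (hfat : ∀ z : E3, ∃ α : Fin 3 → ℝ, z = ∑ m, α m • (y₀ (tr m) - y₀ j) ∧ ∑ m, |α m| ≤ ‖z‖ / μ)
    (htube : ∀ m, ‖(y (tr m) - y j) - (y₀ (tr m) - y₀ j)‖ ≤ sv) (hpin : ∀ i, dist (y i) (y₀ i) ≤ dB) (hdiam : ∀ i k, dist (y₀ k) (y₀ i) ≤ ΔC)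
    (k : Fin n) :
    ‖siteFrame y xf V p (y k) - siteFrame y xf V j (y k)‖ ≤ (1 + 3 * (ΔC + 2 * dB) / (μ - sv)) * Real.sqrt (coreDeficit Rd y₀ y xf V) := by
  have hμ : 0 < μ := lt_of_le_of_lt hs hsμ
  have hμs : 0 < μ - sv := sub_pos.2 hsμ
  set D := Real.sqrt (coreDeficit Rd y₀ y xf V) with hD
  have hD0 : 0 ≤ D := Real.sqrt_nonneg _
  -- the two frames agree at `y j` up to `√D`
  have h0 : ‖siteFrame y xf V p (y j) - siteFrame y xf V j (y j)‖ ≤ D := by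
    rw [siteFrame_self, ← norm_neg, neg_sub]
    exact dist_siteFrame_le_sqrt p j hpar
  -- and at the three tripod sites up to `2√D`
  have h1 : ∀ m, ‖siteFrame y xf V p (y (tr m)) - siteFrame y xf V j (y (tr m))‖ ≤ 2 * D := by
    intro m
    have a := dist_siteFrame_le_sqrt (xf := xf) (y := y) (V := V) p (tr m) (htri m).1
    have b := dist_siteFrame_le_sqrt (xf := xf) (y := y) (V := V) j (tr m) (htri m).2
    calc ‖siteFrame y xf V p (y (tr m)) - siteFrame y xf V j (y (tr m))‖
        ≤ ‖siteFrame y xf V p (y (tr m)) - xf (tr m)‖ + ‖xf (tr m) - siteFrame y xf V j (y (tr m))‖ := norm_sub_le_norm_sub_add_norm_sub _ _ _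
      _ ≤ D + D := by rw [← norm_neg, neg_sub] ; exact add_le_add a b
      _ = 2 * D := by ring
  -- hence the linear parts differ by at most `3√D` on each tripod vector of the FILLING
  have h2 : ∀ m, ‖V p (y (tr m) - y j) - V j (y (tr m) - y j)‖ ≤ 3 * D := by
    intro m
    have e : V p (y (tr m) - y j) - V j (y (tr m) - y j) =
        (siteFrame y xf V p (y (tr m)) - siteFrame y xf V j (y (tr m))) - (siteFrame y xf V p (y j) - siteFrame y xf V j (y j)) := by
      rw [← siteFrame_sub p, ← siteFrame_sub j]; abel
    rw [e]
    calc ‖(siteFrame y xf V p (y (tr m)) - siteFrame y xf V j (y (tr m))) - (siteFrame y xf V p (y j) - siteFrame y xf V j (y j))‖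
        ≤ ‖siteFrame y xf V p (y (tr m)) - siteFrame y xf V j (y (tr m))‖ + ‖siteFrame y xf V p (y j) - siteFrame y xf V j (y j)‖ := norm_sub_le _ _
      _ ≤ 2 * D + D := add_le_add (h1 m) h0
      _ = 3 * D := by ring
  -- the difference of the linear parts as a continuous linear map
  set W : E3 →L[ℝ] E3 := LinearMap.toContinuousLinearMap (((V p).toLinearEquiv : E3 →ₗ[ℝ] E3) - ((V j).toLinearEquiv : E3 →ₗ[ℝ] E3)) with hWdef
  have hW : ∀ z, W z = V p z - V j z := fun z => rfl
  have hWop : ∀ z, ‖V p z - V j z‖ ≤ ‖W‖ * ‖z‖ := fun z => by rw [← hW]; exact W.le_opNorm z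
  have hW0 : 0 ≤ ‖W‖ := norm_nonneg _
  -- on the REFERENCE tripod vectors: `≤ 3√D + ‖W‖·sv`
  have h2' : ∀ m, ‖V p (y₀ (tr m) - y₀ j) - V j (y₀ (tr m) - y₀ j)‖ ≤ 3 * D + ‖W‖ * sv := by
    intro m
    have e : V p (y₀ (tr m) - y₀ j) - V j (y₀ (tr m) - y₀ j) = (V p (y (tr m) - y j) - V j (y (tr m) - y j)) -
        (V p ((y (tr m) - y j) - (y₀ (tr m) - y₀ j)) - V j ((y (tr m) - y j) - (y₀ (tr m) - y₀ j))) := by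
      simp only [map_sub]; abel
    rw [e]
    calc ‖(V p (y (tr m) - y j) - V j (y (tr m) - y j)) -
          (V p ((y (tr m) - y j) - (y₀ (tr m) - y₀ j)) - V j ((y (tr m) - y j) - (y₀ (tr m) - y₀ j)))‖
        ≤ ‖V p (y (tr m) - y j) - V j (y (tr m) - y j)‖ +
            ‖V p ((y (tr m) - y j) - (y₀ (tr m) - y₀ j)) - V j ((y (tr m) - y j) - (y₀ (tr m) - y₀ j))‖ := norm_sub_le _ _
      _ ≤ 3 * D + ‖W‖ * ‖(y (tr m) - y j) - (y₀ (tr m) - y₀ j)‖ := add_le_add (h2 m) (hWop _)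
      _ ≤ 3 * D + ‖W‖ * sv := by gcongr; exact htube m
  -- BOOTSTRAP: by reference fatness `‖W z‖ ≤ ((3√D + ‖W‖·sv)/μ)·‖z‖` for every `z`, hence `‖W‖ ≤ (3√D + ‖W‖·sv)/μ`, hence `‖W‖ ≤ 3√D/(μ − sv)`
  have hall : ∀ z : E3, ‖W z‖ ≤ (3 * D + ‖W‖ * sv) / μ * ‖z‖ := by
    intro z
    obtain ⟨α, hz, hα⟩ := hfat z
    have hV : ∀ V' : E3 ≃ₗᵢ[ℝ] E3, V' z = ∑ m, α m • V' (y₀ (tr m) - y₀ j) := by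
      intro V'
      rw [hz, map_sum]
      exact Finset.sum_congr rfl fun m _ => map_smul V' (α m) _
    have hlin : W z = ∑ m, α m • (V p (y₀ (tr m) - y₀ j) - V j (y₀ (tr m) - y₀ j)) := by
      rw [hW, hV (V p), hV (V j), ← Finset.sum_sub_distrib]
      exact Finset.sum_congr rfl fun m _ => (smul_sub (α m) _ _).symm
    rw [hlin]
    calc ‖∑ m, α m • (V p (y₀ (tr m) - y₀ j) - V j (y₀ (tr m) - y₀ j))‖
        ≤ ∑ m, ‖α m • (V p (y₀ (tr m) - y₀ j) - V j (y₀ (tr m) - y₀ j))‖ := norm_sum_le _ _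
      _ ≤ ∑ m, |α m| * (3 * D + ‖W‖ * sv) := Finset.sum_le_sum fun m _ => by
            rw [norm_smul, Real.norm_eq_abs]; exact mul_le_mul_of_nonneg_left (h2' m) (abs_nonneg _)
      _ = (∑ m, |α m|) * (3 * D + ‖W‖ * sv) := by rw [Finset.sum_mul]
      _ ≤ ‖z‖ / μ * (3 * D + ‖W‖ * sv) := mul_le_mul_of_nonneg_right hα (by positivity)
      _ = (3 * D + ‖W‖ * sv) / μ * ‖z‖ := by ring
  have hM : ‖W‖ ≤ (3 * D + ‖W‖ * sv) / μ := ContinuousLinearMap.opNorm_le_bound W (by positivity) hall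
  have hM' : ‖W‖ ≤ 3 * D / (μ - sv) := by
    rw [le_div_iff₀ hμs, mul_sub]
    have h := (le_div_iff₀ hμ).1 hM
    linarith
  -- on the vector `y k − y j` (length `≤ ΔC + 2dB`)
  have hkj : ‖y k - y j‖ ≤ ΔC + 2 * dB := by
    rw [← dist_eq_norm]
    calc dist (y k) (y j) ≤ dist (y k) (y₀ k) + dist (y₀ k) (y₀ j) + dist (y₀ j) (y j) := dist_triangle4 _ _ _ _
      _ ≤ dB + ΔC + dB := by
          refine add_le_add (add_le_add (hpin k) (hdiam j k)) ?_
          rw [dist_comm]; exact hpin j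
      _ = ΔC + 2 * dB := by ring
  have hdB0 : 0 ≤ dB := le_trans dist_nonneg (hpin j)
  have hΔ0 : 0 ≤ ΔC := le_trans dist_nonneg (hdiam j j)
  have h3 : ‖V p (y k - y j) - V j (y k - y j)‖ ≤ 3 * D / (μ - sv) * (ΔC + 2 * dB) :=
    calc ‖V p (y k - y j) - V j (y k - y j)‖ ≤ ‖W‖ * ‖y k - y j‖ := hWop _
      _ ≤ 3 * D / (μ - sv) * (ΔC + 2 * dB) := mul_le_mul hM' hkj (norm_nonneg _) (by positivity)
  -- assemble: `A_p (y k) − A_j (y k) = (V p − V j)(y k − y j) + (A_p (y j) − A_j (y j))`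
  have e2 : siteFrame y xf V p (y k) - siteFrame y xf V j (y k) =
      (V p (y k - y j) - V j (y k - y j)) + (siteFrame y xf V p (y j) - siteFrame y xf V j (y j)) := by
    rw [← siteFrame_sub p, ← siteFrame_sub j]; abel
  rw [e2]
  calc ‖(V p (y k - y j) - V j (y k - y j)) + (siteFrame y xf V p (y j) - siteFrame y xf V j (y j))‖
      ≤ ‖V p (y k - y j) - V j (y k - y j)‖ + ‖siteFrame y xf V p (y j) - siteFrame y xf V j (y j)‖ := norm_add_le _ _
    _ ≤ 3 * D / (μ - sv) * (ΔC + 2 * dB) + D := add_le_add h3 h0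
    _ = (1 + 3 * (ΔC + 2 * dB) / (μ - sv)) * D := by
        field_simp
        ring

/-- the TRIPOD CONDITIONS at node `j` with parent `p`: the three sites `tr` are in label range `Rd` of `p` and of `j`, and their label vectors from `y₀ j` are
`μ`-fat in `ℓ¹`. -/
def TripodAt (Rd μ : ℝ) (y₀ : Fin n → E3) (p j : Fin n) (tr : Fin 3 → Fin n) : Prop :=
  (∀ m, dist (y₀ p) (y₀ (tr m)) ≤ Rd ∧ dist (y₀ j) (y₀ (tr m)) ≤ Rd) ∧
    ∀ z : E3, ∃ α : Fin 3 → ℝ, z = ∑ m, α m • (y₀ (tr m) - y₀ j) ∧ ∑ m, |α m| ≤ ‖z‖ / μ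

/-- ★★ **`IsLightLabelTree Rd μ ΔC H y₀ i₀ par dep t`** — the LEAF-LIGHT label frame tree: as tree ZZZXA `IsLabelTree` (root, parent strictly decreases the
depth `≤ H`, parent in label range `Rd`, label diameter `≤ ΔC`) but the TRIPOD (range + `ℓ¹`-fatness `μ`) is demanded ONLY AT INTERNAL NODES — at `par i` for
every non-root `i` whose parent is not the root.  LEAVES CARRY NO TRIPOD: a leaf is tied to the root frame through its parent's row of the deficit alone.
(Boundary atoms of the core become leaves; internal nodes are chosen `≥ 3` hops inside — memo PLAN-g90-RGlab.) [this file, g89] -/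
def IsLightLabelTree (Rd μ ΔC : ℝ) (H : ℕ) (y₀ : Fin n → E3) (i₀ : Fin n) (par : Fin n → Fin n) (dep : Fin n → ℕ) (t : Fin n → Fin 3 → Fin n) : Prop :=
  (∀ j, dep j = 0 → j = i₀) ∧ (∀ j, dep j ≠ 0 → dep (par j) < dep j) ∧ (∀ j, dep j ≤ H) ∧
    (∀ j, dep j ≠ 0 → dist (y₀ (par j)) (y₀ j) ≤ Rd) ∧
      (∀ i, dep i ≠ 0 → dep (par i) ≠ 0 → TripodAt Rd μ y₀ (par (par i)) (par i) (t (par i))) ∧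
        ∀ i k, dist (y₀ k) (y₀ i) ≤ ΔC

/-- a full label tree (tree ZZZXA) is a light one (PROVED, projection). -/
theorem IsLabelTree.light {Rd μ ΔC : ℝ} {H : ℕ} {y₀ : Fin n → E3} {i₀ : Fin n} {par : Fin n → Fin n} {dep : Fin n → ℕ} {t : Fin n → Fin 3 → Fin n}
    (hT : IsLabelTree Rd μ ΔC H y₀ i₀ par dep t) : IsLightLabelTree Rd μ ΔC H y₀ i₀ par dep t := by
  obtain ⟨h1, h2, h3, h4, h5, h6, h7⟩ := hT
  exact ⟨h1, h2, h3, h4, fun i _ hp => ⟨h5 (par i) hp, h6 (par i) hp⟩, h7⟩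

variable {i₀ : Fin n} {par : Fin n → Fin n} {dep : Fin n → ℕ} {t : Fin n → Fin 3 → Fin n}

/-- ALONG THE LIGHT TREE (PROVED): for every non-root `i` whose parent has depth `≤ d`, the PARENT's frame differs from the root frame everywhere by at most
`d·(1 + 3(ΔC + 2dB)/(μ − sv))·√D` — induction on `d` through internal nodes only. -/
theorem lightTree_parent_sub_root_le (hs : 0 ≤ sv) (hsμ : sv < μ) (hT : IsLightLabelTree Rd μ ΔC H y₀ i₀ par dep t)
    (htube : ∀ i, dep i ≠ 0 → dep (par i) ≠ 0 → ∀ m, ‖(y (t (par i) m) - y (par i)) - (y₀ (t (par i) m) - y₀ (par i))‖ ≤ sv)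
    (hpin : ∀ i, dist (y i) (y₀ i) ≤ dB) :
    ∀ (d : ℕ) (i : Fin n), dep i ≠ 0 → dep (par i) ≤ d → ∀ k : Fin n,
      ‖siteFrame y xf V (par i) (y k) - siteFrame y xf V i₀ (y k)‖ ≤ d * ((1 + 3 * (ΔC + 2 * dB) / (μ - sv)) * Real.sqrt (coreDeficit Rd y₀ y xf V)) := by
  obtain ⟨hroot, hdec, _, hpar, htri, hdiam⟩ := hT
  have hc : 0 ≤ (1 + 3 * (ΔC + 2 * dB) / (μ - sv)) * Real.sqrt (coreDeficit Rd y₀ y xf V) := by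
    have hΔ : 0 ≤ ΔC := le_trans dist_nonneg (hdiam i₀ i₀)
    have hdB0 : 0 ≤ dB := le_trans dist_nonneg (hpin i₀)
    have hμs : 0 < μ - sv := sub_pos.2 hsμ
    positivity
  intro d
  induction d with
  | zero =>
      intro i hi hd k
      rw [hroot (par i) (Nat.le_zero.1 hd), sub_self, norm_zero, Nat.cast_zero, zero_mul]
  | succ d ih =>
      intro i hi hd k
      by_cases h0 : dep (par i) = 0
      · rw [hroot (par i) h0, sub_self, norm_zero]
        positivity
      · have hp : dep (par (par i)) ≤ d := Nat.lt_succ_iff.1 (lt_of_lt_of_le (hdec (par i) h0) hd)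
        have e := ih (par i) h0 hp k
        obtain ⟨htr, hfat⟩ := htri i hi h0
        have f := frameEdge_sub_le (xf := xf) (V := V) hs hsμ (hpar (par i) h0) htr hfat (htube i hi h0) hpin hdiam k
        rw [← norm_neg, neg_sub] at f
        calc ‖siteFrame y xf V (par i) (y k) - siteFrame y xf V i₀ (y k)‖
            ≤ ‖siteFrame y xf V (par i) (y k) - siteFrame y xf V (par (par i)) (y k)‖ +
                ‖siteFrame y xf V (par (par i)) (y k) - siteFrame y xf V i₀ (y k)‖ := norm_sub_le_norm_sub_add_norm_sub _ _ _
          _ ≤ (1 + 3 * (ΔC + 2 * dB) / (μ - sv)) * Real.sqrt (coreDeficit Rd y₀ y xf V) +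
                d * ((1 + 3 * (ΔC + 2 * dB) / (μ - sv)) * Real.sqrt (coreDeficit Rd y₀ y xf V)) := add_le_add f e
          _ = (d + 1 : ℕ) * ((1 + 3 * (ΔC + 2 * dB) / (μ - sv)) * Real.sqrt (coreDeficit Rd y₀ y xf V)) := by push_cast; ring

/-- ★★★ **(RG-fin″) LEAF-LIGHT CHAIN-POINCARÉ RIGIDITY (PROVED, finite-dimensional)** — the conclusion of tree ZZZXA `rigidMisfit_root_le_of_labelTree` VERBATIM
(`rigidMisfit y xf (V i₀) (xf i₀ − V i₀ (y i₀)) ≤ n·H²·(1 + 3(ΔC + 2dB)/(μ − sv))²·coreDeficit Rd y₀ y xf V`, every rotation field `V`) from the LIGHT tree: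
a leaf `i` is within `√D` of its parent's frame at `y i` (the parent's row of the deficit), and the parent's frame is within `(H − 1)·c·√D` of the root's;
since `c ≥ 1` the site bound `H·c·√D` is unchanged. [this file, g89] -/
theorem rigidMisfit_root_le_of_lightLabelTree (hs : 0 ≤ sv) (hsμ : sv < μ) (hT : IsLightLabelTree Rd μ ΔC H y₀ i₀ par dep t)
    (htube : ∀ i, dep i ≠ 0 → dep (par i) ≠ 0 → ∀ m, ‖(y (t (par i) m) - y (par i)) - (y₀ (t (par i) m) - y₀ (par i))‖ ≤ sv)
    (hpin : ∀ i, dist (y i) (y₀ i) ≤ dB) :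
    rigidMisfit y xf (V i₀) (xf i₀ - V i₀ (y i₀)) ≤ n * H ^ 2 * (1 + 3 * (ΔC + 2 * dB) / (μ - sv)) ^ 2 * coreDeficit Rd y₀ y xf V := by
  set D := Real.sqrt (coreDeficit Rd y₀ y xf V) with hD
  set c := (1 + 3 * (ΔC + 2 * dB) / (μ - sv)) * D with hc
  have hroot := hT.1
  have hdec := hT.2.1
  have hH := hT.2.2.1
  have hpar := hT.2.2.2.1
  have hdiam := hT.2.2.2.2.2
  have hD0 : 0 ≤ D := Real.sqrt_nonneg _
  have hΔ : 0 ≤ ΔC := le_trans dist_nonneg (hdiam i₀ i₀)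
  have hdB0 : 0 ≤ dB := le_trans dist_nonneg (hpin i₀)
  have hμs : 0 < μ - sv := sub_pos.2 hsμ
  have hc0 : 0 ≤ c := by positivity
  have hDc : D ≤ c := by
    have h1 : (1 : ℝ) ≤ 1 + 3 * (ΔC + 2 * dB) / (μ - sv) := le_add_of_nonneg_right (by positivity)
    calc D = 1 * D := (one_mul D).symm
      _ ≤ (1 + 3 * (ΔC + 2 * dB) / (μ - sv)) * D := mul_le_mul_of_nonneg_right h1 hD0
  have hsite : ∀ j, ‖xf j - (V i₀ (y j) + (xf i₀ - V i₀ (y i₀)))‖ ^ 2 ≤ (H * c) ^ 2 := by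
    intro j
    have e : V i₀ (y j) + (xf i₀ - V i₀ (y i₀)) = siteFrame y xf V i₀ (y j) := by
      simp only [siteFrame, map_sub]; abel
    rw [e]
    refine pow_le_pow_left₀ (norm_nonneg _) ?_ 2
    by_cases h0 : dep j = 0
    · rw [hroot j h0, siteFrame_self, sub_self, norm_zero]
      positivity
    · -- leaf or not: through the parent's row and the parent's chain
      have hlt : dep (par j) < dep j := hdec j h0
      have hHj : dep j ≤ H := hH j
      have hH1 : 1 ≤ H := le_trans (Nat.one_le_iff_ne_zero.2 h0) hHj
      have hpd : dep (par j) ≤ H - 1 := by omega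
      have a : ‖xf j - siteFrame y xf V (par j) (y j)‖ ≤ D := dist_siteFrame_le_sqrt (par j) j (hpar j h0)
      have b := lightTree_parent_sub_root_le (xf := xf) (V := V) hs hsμ hT htube hpin (H - 1) j h0 hpd j
      have hcast : ((H - 1 : ℕ) : ℝ) = (H : ℝ) - 1 := by rw [Nat.cast_sub hH1, Nat.cast_one]
      rw [hcast] at b
      calc ‖xf j - siteFrame y xf V i₀ (y j)‖
          ≤ ‖xf j - siteFrame y xf V (par j) (y j)‖ + ‖siteFrame y xf V (par j) (y j) - siteFrame y xf V i₀ (y j)‖ := norm_sub_le_norm_sub_add_norm_sub _ _ _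
        _ ≤ D + ((H : ℝ) - 1) * c := add_le_add a b
        _ ≤ c + ((H : ℝ) - 1) * c := by linarith
        _ = H * c := by ring
  calc rigidMisfit y xf (V i₀) (xf i₀ - V i₀ (y i₀)) = ∑ j, ‖xf j - (V i₀ (y j) + (xf i₀ - V i₀ (y i₀)))‖ ^ 2 := rfl
    _ ≤ ∑ _j : Fin n, (H * c) ^ 2 := Finset.sum_le_sum fun j _ => hsite j
    _ = n * (H * c) ^ 2 := by rw [Finset.sum_const, Finset.card_univ, Fintype.card_fin, nsmul_eq_mul]
    _ = n * H ^ 2 * (1 + 3 * (ΔC + 2 * dB) / (μ - sv)) ^ 2 * D ^ 2 := by rw [hc]; ring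
    _ = n * H ^ 2 * (1 + 3 * (ΔC + 2 * dB) / (μ - sv)) ^ 2 * coreDeficit Rd y₀ y xf V := by rw [hD, Real.sq_sqrt coreDeficit_nonneg]

end LightTree

/-! ### ZZZXB-2  (RG-lab″) the light S-side leaf, the glue, the bridge from (RG-lab) (PROVED) -/

section Reduction

/-- ★★★ **(RG-lab″) «CoreLightLabelTreeP … Rd N₀ H₀ μC ΔC …» — THE LABELLED CORE CARRIES A BOUNDED, SHALLOW SPANNING TREE, FAT AT ITS INTERNAL NODES.**  Tree ZZZXA's (RG-lab) with `IsLabelTree` ↦ `IsLightLabelTree` (tripods at internal nodes only); everything else VERBATIM.  Under the binders of (RGᴸ)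
`DeficitRigidityP` up to the bond label (verbatim: θ-good `aHi`-door set, LJ summable, equilibrium chart, container, `ϑp`-mild `rm`-core, `ϑc`-cool moat,
enumerated `ρ`-core `xf`, cool shadow crystal, bond label `lab`) — and NOTHING ELSE: no filling, no tube, no rotation field, no deficit — the core has AT
MOST `N₀` sites, and if it is non-empty there are a root `i₀`, a parent map, a depth map `≤ H₀` and tripods forming an `IsLightLabelTree Rd μC ΔC H₀ (lab ∘ xf) …`
(parent IN RANGE `Rd` for the labels; AT INTERNAL NODES a tripod in range of the node and its parent with LABEL vectors `μC`-fat; label diameter `≤ ΔC`).  KINEMATIC · LJ-free · y-free · V-free · S-SIDE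
combinatorial geometry of the labelled core · NEW · UNDECIDED · TRUE-type at `Rd = 121/25` for suitable explicit `(N₀, H₀, μC, ΔC)` (BFS tree of the core
bond graph rooted in `K`; toward the nearest container atom at least three first-shell neighbours lie in the core and no three same-side first-shell
vectors of fcc/hcp are coplanar; `lab` restricted to a star is a graph isomorphism of (anti)cuboctahedra, hence a point-group image; packing) ·
ATTACKABLE-S · size M.  Why it might fail: only a mis-set constant (only `0 < N₀, 0 < H₀, sb₁ < μC, 0 ≤ ΔC` are consumed downstream); the boundary-atom tripod issue of (RG-lab)
is GONE (leaves carry no tripod; internal nodes are chosen `≥ 3` hops inside the core, memo PLAN-g90-RGlab).  Sources: this file's docstring; FJM 2002 §3 (discrete rigidity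
by chaining local frames); tree ZZZV (Barlow first-shell tables). [this file, g89] -/
def CoreLightLabelTreeP (ϑc ϑp r rΘ q rsh ρ rm σ ϑr Rs ε rI ℓ Rd : ℝ) (N₀ H₀ : ℕ) (μC ΔC aHi Λ θ s : ℝ) : Prop :=
  ∀ δ : ℝ, 0 < δ → ∀ a : ℝ, 0 < a →
    ∀ S : Set E3, IsDoorSetP aHi δ S → (∀ z : E3, Summable fun y : S => lennardJones (dist z (y : E3))) →
      (∀ p ∈ S, IsTwoShellAffineGood θ S p) →
        ∀ (L : E3 ≃L[ℝ] E3) (w : ℤ → E3), IsEquilChart a s Λ L w →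
          ∀ (x₀ : E3) (K : Set E3), K ⊆ S → (∀ k ∈ K, dist k x₀ ≤ q) →
            IsTameOn ϑp S (LayeredHom (L : E3 →L[ℝ] E3) w) (coreOf S K rm) →
              IsTameOn ϑc S (LayeredHom (L : E3 →L[ℝ] E3) w) (moatIn S K r (r + rsh)) →
                ∀ (n : ℕ) (xf : Fin n → E3), Function.Injective xf → Set.range xf = coreOf S K ρ →
                  ∀ (L' : E3 →L[ℝ] E3) (w' : ℤ → E3) (U : E3 ≃ₗᵢ[ℝ] E3) (t : E3),
                    IsCoolShadowCrystal σ ϑr Rs ε r rI ℓ S K (LayeredHom (L : E3 →L[ℝ] E3) w) L' w' U t →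
                      ∀ lab : E3 → E3, IsBondLabel ε rΘ ℓ S K (placedCrystal L' w' U t) lab →
                        n ≤ N₀ ∧ (n ≠ 0 → ∃ (i₀ : Fin n) (par : Fin n → Fin n) (dep : Fin n → ℕ) (tri : Fin n → Fin 3 → Fin n),
                          IsLightLabelTree Rd μC ΔC H₀ (fun i => lab (xf i)) i₀ par dep tri)

-- (lane edit hand-2 g42, dedup.landed) the positivity of the explicit rigidity constant is the TREE lemma `labelChainRigidityConst_pos` of
-- `…LiouvilleZZZXA` (byte-identical statement); the lens's local copy (formerly `lightChainRigidityConst_pos` here) is dropped and its two uses below cite the tree name.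

/-- ★★★ **THE GLUE (PROVED): (RGᴸ)(`cR = 1/(N₀·H₀²·(1 + 3(ΔC + 2dB₁)/(μC − sb₁))²)`) ⟸ (RG-lab″)(N₀, H₀, μC, ΔC)** at pair range `Rd ≤ Rg` and tube radius
`0 ≤ sb₁ < μC`.  The VECTOR bond tube puts the filling's tripod vectors within `sb₁` of the label ones (tripods are in range `Rd ≤ Rg`) and its sites within
`dB₁` of the labels; (RG-fin″) then bounds the misfit from the root frame's rigid copy (rotation `V i₀`, proper because the field is) by
`n·(…)·D ≤ N₀·(…)·D`; an empty core has misfit `0`. [this file, g89] -/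
theorem deficitRigidityP_of_coreLightLabelTree {ϑc ϑp r rΘ q rsh ρ rm σ ϑr Rs ε rI ℓ Rg sb₁ dI₁ dB₁ Rd μC ΔC aHi Λ θ s : ℝ} {N₀ H₀ : ℕ} (hN : 0 < N₀)
    (hH : 0 < H₀) (hΔ : 0 ≤ ΔC) (hRd : Rd ≤ Rg) (hsb₀ : 0 ≤ sb₁) (hsb : sb₁ < μC) (hdB₀ : 0 ≤ dB₁)
    (hG : CoreLightLabelTreeP ϑc ϑp r rΘ q rsh ρ rm σ ϑr Rs ε rI ℓ Rd N₀ H₀ μC ΔC aHi Λ θ s) :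
    DeficitRigidityP ϑc ϑp r rΘ q rsh ρ rm σ ϑr Rs ε rI ℓ Rg sb₁ dI₁ dB₁ Rd
      (1 / ((N₀ : ℝ) * (H₀ : ℝ) ^ 2 * (1 + 3 * (ΔC + 2 * dB₁) / (μC - sb₁)) ^ 2)) aHi Λ θ s := by
  intro δ hδ a ha S hS hsum hgood L w hLw x₀ K hKS hKq hmild hcool n xf hxf hrange L' w' U t hC lab hlab y hy V hV
  obtain ⟨hn, htree⟩ := hG δ hδ a ha S hS hsum hgood L w hLw x₀ K hKS hKq hmild hcool n xf hxf hrange L' w' U t hC lab hlab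
  have hμs : 0 < μC - sb₁ := sub_pos.2 hsb
  have hK : 0 < (N₀ : ℝ) * (H₀ : ℝ) ^ 2 * (1 + 3 * (ΔC + 2 * dB₁) / (μC - sb₁)) ^ 2 := by positivity
  have hD : 0 ≤ coreDeficit Rd (fun i => lab (xf i)) y xf V := coreDeficit_nonneg
  by_cases h0 : n = 0
  · subst h0
    refine ⟨LinearIsometryEquiv.refl ℝ E3, 0, det_refl_E3_eq_one, ?_⟩
    have hz : rigidMisfit y xf (LinearIsometryEquiv.refl ℝ E3) 0 = 0 := by simp [rigidMisfit]
    rw [hz, mul_zero]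
    exact hD
  · obtain ⟨i₀, par, dep, tri, hT⟩ := htree h0
    refine ⟨V i₀, xf i₀ - V i₀ (y i₀), hV i₀, ?_⟩
    have hy' := mem_bondTube_iff.1 hy
    have htube : ∀ i, dep i ≠ 0 → dep (par i) ≠ 0 →
        ∀ m, ‖(y (tri (par i) m) - y (par i)) - (lab (xf (tri (par i) m)) - lab (xf (par i)))‖ ≤ sb₁ := by
      intro i hi hp m
      rw [← dist_eq_norm]
      refine hy'.1 (tri (par i) m) (par i) ?_
      rw [dist_comm]
      exact (((hT.2.2.2.2.1 i hi hp).1 m).2).trans hRd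
    have hpin : ∀ i, dist (y i) (lab (xf i)) ≤ dB₁ := fun i => hy'.2.2 i
    have hfin := rigidMisfit_root_le_of_lightLabelTree (xf := xf) (V := V) hsb₀ hsb hT htube hpin
    have hnN : (n : ℝ) * (H₀ : ℝ) ^ 2 * (1 + 3 * (ΔC + 2 * dB₁) / (μC - sb₁)) ^ 2 ≤
        (N₀ : ℝ) * (H₀ : ℝ) ^ 2 * (1 + 3 * (ΔC + 2 * dB₁) / (μC - sb₁)) ^ 2 := by
      have : (n : ℝ) ≤ N₀ := by exact_mod_cast hn
      gcongr
    rw [one_div, inv_mul_le_iff₀ hK]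
    exact hfin.trans (mul_le_mul_of_nonneg_right hnN hD)

/-- (RG-lab) ⟹ (RG-lab″) (PROVED): the leaf of record of tree ZZZXA implies the light leaf — the new door's hypothesis is WEAKER-OR-EQUAL. -/
theorem coreLightLabelTreeP_of_coreLabelTreeP {ϑc ϑp r rΘ q rsh ρ rm σ ϑr Rs ε rI ℓ Rd μC ΔC aHi Λ θ s : ℝ} {N₀ H₀ : ℕ}
    (hG : CoreLabelTreeP ϑc ϑp r rΘ q rsh ρ rm σ ϑr Rs ε rI ℓ Rd N₀ H₀ μC ΔC aHi Λ θ s) :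
    CoreLightLabelTreeP ϑc ϑp r rΘ q rsh ρ rm σ ϑr Rs ε rI ℓ Rd N₀ H₀ μC ΔC aHi Λ θ s := by
  intro δ hδ a ha S hS hsum hgood L w hLw x₀ K hKS hKq hmild hcool n xf hxf hrange L' w' U t hC lab hlab
  obtain ⟨hn, htree⟩ := hG δ hδ a ha S hS hsum hgood L w hLw x₀ K hKS hKq hmild hcool n xf hxf hrange L' w' U t hC lab hlab
  refine ⟨hn, fun h0 => ?_⟩
  obtain ⟨i₀, par, dep, tri, hT⟩ := htree h0
  exact ⟨i₀, par, dep, tri, hT.light⟩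

end Reduction

/-! ### ZZZXB-3  The doors: [MCMC♮] from (RG-lab″) (PROVED) -/

section Doors

/-- ★★★ **THE DOOR W2c WITH GRAPH RIGIDITY DISCHARGED TO LABEL GEOMETRY (PROVED)**: `[MCMC♮](ϑc) ⟸ (SC♮) ∧ (X1ᴸ)(lam > 0) ∧ (X2ᴸ) ∧ (RG-lab″)(N₀, H₀, μC, ΔC) ∧
(DWᴹ)(cE, σ₀)` with `σ₀ < cE·cR·10⁻⁴`, `cR = 1/(N₀·H₀²·(1 + 3(ΔC + 2dB₁)/(μC − sb₁))²)`, for `249/20000 < μC` — tree ZZZWB's W2c⁺ door with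
`hRG := deficitRigidityP_of_coreLightLabelTree` (`Rd = Rg = 121/25`, `sb₁ ≤ 249/20000 < μC`). [this file, g89] -/
theorem mildCoherentMoatCorePG_W2c_of_lightLabelTree {ϑc sb₁ dI₁ dB₁ lam cE σ₀ μC ΔC : ℝ} {N₀ H₀ : ℕ} (hlam : 0 < lam) (hcE : 0 ≤ cE) (hN : 0 < N₀)
    (hH : 0 < H₀) (hμ : 249 / 20000 < μC) (hΔ : 0 ≤ ΔC)
    (hgap : σ₀ < cE * (1 / ((N₀ : ℝ) * (H₀ : ℝ) ^ 2 * (1 + 3 * (ΔC + 2 * dB₁) / (μC - sb₁)) ^ 2) * (1 / 10000))) (hsb : 4 * sb₁ ≤ 249 / 5000)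
    (hdI : 4 * dI₁ ≤ 249 / 5000) (hdB : dB₁ ≤ 2 / 5) (hsb₀ : 0 ≤ sb₁) (hdI₀ : 0 ≤ dI₁) (hdB₀ : 0 ≤ dB₁)
    (hSC : CoherentZoneShadowCrystalP ϑc (1 / 10) 8 4 12 16 (17 / 20) (1 / 10000) 5 (1 / 10000) 10 (43 / 2) 1 2 (1 / 16) (1 / 50))
    (hX1 : LabelTubeConvexityP ϑc tameRadius (1 / 10) 8 (145 / 16) 4 12 16 16 (17 / 20) (1 / 10000) 5 (1 / 10000) 10 (43 / 2) (1 / 5000) (121 / 25)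
      (249 / 5000) (249 / 5000) (21 / 50) lam 1 2 (1 / 16) (1 / 50))
    (hX2 : LabelLoadedTubeAprioriP ϑc tameRadius (1 / 10) 8 (145 / 16) 4 12 16 16 (17 / 20) (1 / 10000) 5 (1 / 10000) 10 (43 / 2) (1 / 5000)
      (121 / 25) (249 / 5000) (249 / 5000) (21 / 50) sb₁ dI₁ dB₁ 1 2 (1 / 16) (1 / 50))
    (hLT : CoreLightLabelTreeP ϑc (1 / 10) 8 (145 / 16) 4 12 16 16 (17 / 20) (1 / 10000) 5 (1 / 10000) 10 (43 / 2) (121 / 25) N₀ H₀ μC ΔC 1 2 (1 / 16)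
      (1 / 50))
    (hDW : DeficitWellMinP ϑc tameRadius (1 / 10) 8 (145 / 16) 4 12 16 16 (17 / 20) (1 / 10000) 5 (1 / 10000) 10 (43 / 2) (121 / 25) sb₁ dI₁ dB₁
      (121 / 25) cE σ₀ 1 2 (1 / 16) (1 / 50)) :
    MildCoherentMoatCorePG ϑc tameRadius (1 / 10) 8 4 12 16 1 2 (1 / 16) (1 / 50) :=
  have hsμ : sb₁ < μC := by linarith
  mildCoherentMoatCorePG_W2c_of_labelChain hlam (labelChainRigidityConst_pos hN hH hΔ hdB₀ hsμ).le hcE hgap hsb hdI hdB hsb₀ hdI₀ hdB₀ hSC hX1 hX2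
    (deficitRigidityP_of_coreLightLabelTree hN hH hΔ le_rfl hsb₀ hsμ hdB₀ hLT) hDW

/-- ★★★★ **THE DOOR OF RECORD AT THE EXACT WELL (PROVED) — `[MCMC♮](ϑc) ⟸ (SC♮) ∧ (X1ᴸ)(lam > 0) ∧ (X2ᴸ) ∧ (RG-lab″)(N₀, H₀, μC, ΔC) ∧ (DWᴹ)(cE, 0)`,
`0 < cE`, `249/20000 < μC`** (critic row 1586, SCOPE-RG ruling: `σ₀ := 0` of record): the side condition `0 < cE·cR·10⁻⁴` holds for the explicit `cR > 0` of the
chain-Poincaré glue, so NO rigidity constant appears among the hypotheses.  Residual leaves of the W2 line: (SC♮) [KINEMATIC · ATTACKABLE], (X1ᴸ)/(X2ᴸ)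
[ANALYTIC · HEAVY], (RG-lab″) [KINEMATIC · S-side, y-free, leaf-light · ATTACKABLE-S], (DWᴹ)(cE, 0) [ENERGETIC · exact well].  Tree ZZZXA's door of record follows from
this one through `coreLightLabelTreeP_of_coreLabelTreeP`. [this file, g89] -/
theorem mildCoherentMoatCorePG_W2c_exactWell_light {ϑc sb₁ dI₁ dB₁ lam cE μC ΔC : ℝ} {N₀ H₀ : ℕ} (hlam : 0 < lam) (hcE : 0 < cE) (hN : 0 < N₀) (hH : 0 < H₀)
    (hμ : 249 / 20000 < μC) (hΔ : 0 ≤ ΔC) (hsb : 4 * sb₁ ≤ 249 / 5000) (hdI : 4 * dI₁ ≤ 249 / 5000) (hdB : dB₁ ≤ 2 / 5) (hsb₀ : 0 ≤ sb₁)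
    (hdI₀ : 0 ≤ dI₁) (hdB₀ : 0 ≤ dB₁)
    (hSC : CoherentZoneShadowCrystalP ϑc (1 / 10) 8 4 12 16 (17 / 20) (1 / 10000) 5 (1 / 10000) 10 (43 / 2) 1 2 (1 / 16) (1 / 50))
    (hX1 : LabelTubeConvexityP ϑc tameRadius (1 / 10) 8 (145 / 16) 4 12 16 16 (17 / 20) (1 / 10000) 5 (1 / 10000) 10 (43 / 2) (1 / 5000) (121 / 25)
      (249 / 5000) (249 / 5000) (21 / 50) lam 1 2 (1 / 16) (1 / 50))
    (hX2 : LabelLoadedTubeAprioriP ϑc tameRadius (1 / 10) 8 (145 / 16) 4 12 16 16 (17 / 20) (1 / 10000) 5 (1 / 10000) 10 (43 / 2) (1 / 5000)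
      (121 / 25) (249 / 5000) (249 / 5000) (21 / 50) sb₁ dI₁ dB₁ 1 2 (1 / 16) (1 / 50))
    (hLT : CoreLightLabelTreeP ϑc (1 / 10) 8 (145 / 16) 4 12 16 16 (17 / 20) (1 / 10000) 5 (1 / 10000) 10 (43 / 2) (121 / 25) N₀ H₀ μC ΔC 1 2 (1 / 16)
      (1 / 50))
    (hDW : DeficitWellMinP ϑc tameRadius (1 / 10) 8 (145 / 16) 4 12 16 16 (17 / 20) (1 / 10000) 5 (1 / 10000) 10 (43 / 2) (121 / 25) sb₁ dI₁ dB₁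
      (121 / 25) cE 0 1 2 (1 / 16) (1 / 50)) :
    MildCoherentMoatCorePG ϑc tameRadius (1 / 10) 8 4 12 16 1 2 (1 / 16) (1 / 50) :=
  have hsμ : sb₁ < μC := by linarith
  mildCoherentMoatCorePG_W2c_of_lightLabelTree hlam hcE.le hN hH hμ hΔ
    (mul_pos hcE (mul_pos (labelChainRigidityConst_pos hN hH hΔ hdB₀ hsμ) (by norm_num))) hsb hdI hdB hsb₀ hdI₀ hdB₀ hSC hX1 hX2 hLT hDW

end Doors
end Summit.AtomisticToContinuum.Crystallization.Theorems.ChartedZeroExcessLayeredLatticeLiouville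

end
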